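import Mathlib
import Summits.NavierStokesRegularity.FluidComputer.TransportSobolevEnergy
import HarnessLib

/-!
# The transport term on the lattice Sobolev scale, VII: self-advection and the order-`σ` energy inequality (instab g19, cell `ns-blowup`, 2026-08-27)

HONEST FRAMING (human ruling D-0035): nothing here is a claim about Navier–Stokes blow-up.
WHAT THIS IS NOT: not NS evidence — lattice (`ℤ^d`, Fourier-side) inequalities between real numbers
and `ℝ≥0∞` sums for RAPIDLY DECREASING coefficient families (every Galerkin level is finitely
supported). No flow, set `W` or certificate is constructed.

PURPOSE (see part VI, `TransportSobolevEnergy`): the `H^σ` energy inequality of the perturbation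
field about a smooth host, with level-independent constants — the differential inequality from which
RESIDENCE (β3) of the R-β chain follows by Gronwall once the bootstrap's `H²` bound is fed in.

* §3 `abs_re_pairing_wmul_natCast_transport_self_le` — self-advection at order `σ ≥ 1`:
  `|Re⟨Λ^σ T_{π∘u} u, Λ^σ u⟩| ≤ card d·σ2^σ·2π·A₁(u)·‖u‖_σ²` (skewness `TransportSkewLattice` + the
  rough × rough commutator of part IV; `A₁(u) = ∑_p ⟨p⟩‖u p‖` is the ONE super-linear factor);
* §5 `two_re_pairing_field_le` — for the coefficient field `P ∘ (linCoeff ν Uv π u + bilCoeff π u u)`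
  of `TransportGalerkinDefs` against a `P`-fixed, real, divergence-free, rapidly decreasing `u`:
  `2 Re⟨Λ^σ P(lin u + bil(u,u)), Λ^σ u⟩ ≤ −2ν(2π)²(S_{σ+1} − S_σ) + 2(H₁ + H₂ + K_σ A₁(u)) S_σ`
  with the host constants `H₁`, `H₂` of part VI §2/§4 and `K_σ = card d·σ2^σ·2π`.

References: classical `H^m` energy method (Majda–Bertozzi 2002 §3.2; Constantin–Foias 1988 Ch. 10)
[folklore shape]; Kato–Ponce 1988 [folklore shape].
-/

noncomputable section

open scoped ENNReal NNReal ComplexConjugate InnerProductSpace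

namespace Summit.NavierStokesRegularity.FluidComputer.TransportSobolevSelfAdvection

open Finset Complex
open Literature.Analysis.FunctionSpaces Literature.Analysis.FunctionSpaces.Lattice
open Literature.Analysis.FunctionSpaces.Torus
open Summit.NavierStokesRegularity.FluidComputer.TransportCommutatorLattice
open Summit.NavierStokesRegularity.FluidComputer.TransportSkewLattice
open Summit.NavierStokesRegularity.FluidComputer.TransportLinearisedLattice
open Summit.NavierStokesRegularity.FluidComputer.TransportSobolevCommutator
open Summit.NavierStokesRegularity.FluidComputer.TransportSobolevMultiplier
open Summit.NavierStokesRegularity.FluidComputer.TransportSobolevEnergy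
open Summit.NavierStokesRegularity.FluidComputer.TransportGalerkin
open Summit.NavierStokesRegularity.FluidComputer.TransportGalerkinRapid

variable {d : Type*} [Fintype d]
variable {V : Type*} [NormedAddCommGroup V] [InnerProductSpace ℂ V] [CompleteSpace V]

/-! ## §3 Self-advection, every order -/

section SelfTransport

omit [CompleteSpace V] in
/-- `A₀(∂_j u) ≤ 2π A₁(u)`: `∑_l ‖(∂_j u) l‖ ≤ 2π ∑_l ⟨l⟩ ‖u l‖`. -/
theorem tsum_enorm_freqDeriv_le (j : d) (u : (d → ℤ) → V) :
    ∑' l, ‖freqDeriv j u l‖ₑ ≤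
      ENNReal.ofReal (2 * Real.pi) * ∑' l, ENNReal.ofReal (sobolevWeight 1 l) * ‖u l‖ₑ := by
  rw [← ENNReal.tsum_mul_left]
  refine ENNReal.tsum_le_tsum fun l => ?_
  rw [← ofReal_norm, ← ofReal_norm, norm_freqDeriv_apply,
    ← ENNReal.ofReal_mul (sobolevWeight_pos 1 l).le, ← ENNReal.ofReal_mul (by positivity)]
  refine ENNReal.ofReal_le_ofReal ?_
  have h := mul_le_mul_of_nonneg_right (abs_apply_le_sobolevWeight_one l j) (norm_nonneg (u l))
  nlinarith [Real.pi_pos, norm_nonneg (u l), sobolevWeight_pos 1 l]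

omit [Fintype d] [CompleteSpace V] in
/-- The component symbol `scal (π_j ∘ u)` is dominated modewise by `u` when `‖π_j‖ ≤ 1`. -/
theorem norm_scal_comp_le (π : d → (V →L[ℂ] ℂ)) (hπ : ∀ j, ‖π j‖ ≤ 1) (u : (d → ℤ) → V)
    (j : d) (p : d → ℤ) : ‖(scal (fun p => π j (u p)) : (d → ℤ) → (V →L[ℂ] V)) p‖ ≤ ‖u p‖ := by
  rw [scal_apply, ContinuousLinearMap.one_def, norm_smul]
  calc ‖π j (u p)‖ * ‖ContinuousLinearMap.id ℂ V‖ ≤ ‖π j (u p)‖ * 1 :=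
        mul_le_mul_of_nonneg_left ContinuousLinearMap.norm_id_le (norm_nonneg _)
    _ ≤ ‖u p‖ := by rw [mul_one]; exact norm_comp_le π hπ u j p

/-- **Self-advection at order `σ ≥ 1`**: for a rapidly decreasing `u` that is REAL and
DIVERGENCE-FREE through coordinate functionals `π_j` of norm `≤ 1` (the box clauses of
`TransportGalerkin.box`), with `T_{π∘u} u = ∑_j (π_j ∘ u) ⋆ ∂_j u` the coefficients of `(u·∇)u`,

  `|Re ⟨Λ^σ T_{π∘u} u, Λ^σ u⟩| ≤ card d · σ2^σ · 2π · A₁(u) · ‖u‖_σ²`,  `A₁(u) = ∑_p ⟨p⟩ ‖u p‖`.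

Skewness kills the top-order term; each commutator `[Λ^σ, (π_j∘u) ⋆]∂_j u` is bounded by part IV's
rough × rough estimate, in which both terms are `≤ 2π A₁(u) ‖u‖_σ`. The ONE super-linear factor
`A₁(u)` (the Wiener norm of `∇u`) is what dissipation must absorb. -/
theorem abs_re_pairing_wmul_natCast_transport_self_le (π : d → (V →L[ℂ] ℂ)) (hπ : ∀ j, ‖π j‖ ≤ 1)
    {u : (d → ℤ) → V} (hu : RapidDecay u) (hreal : ∀ j p, π j (u (-p)) = conj (π j (u p)))
    (hdiv : ∑ j, freqDeriv j (fun p => π j (u p)) = 0) {σ : ℕ} (hσ : 1 ≤ σ) :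
    |(pairing (wmul (σ : ℝ) (∑ j, conv (scal (fun p => π j (u p))) (freqDeriv j u)))
        (wmul (σ : ℝ) u)).re| ≤
      (Fintype.card d : ℝ) * (σ * (2 : ℝ) ^ σ) * (2 * Real.pi) *
        (∑' l, ENNReal.ofReal (sobolevWeight 1 l) * ‖u l‖ₑ).toReal * (eNormSq (σ : ℝ) u).toReal := by
  set y : d → (d → ℤ) → ℂ := fun j p => π j (u p) with hy
  have hyr : ∀ j, RapidDecay (y j) := fun j => hu.comp_apply (π j)
  have ha : ∀ j, RapidDecay (scal (y j) : (d → ℤ) → (V →L[ℂ] V)) := fun j => (hyr j).scal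
  set C : ℝ := σ * (2 : ℝ) ^ (σ - 1) with hC
  have hC0 : 0 ≤ C := by positivity
  have hC2 : 2 * C = σ * (2 : ℝ) ^ σ := by
    rw [hC, show (2 : ℝ) ^ σ = 2 ^ (σ - 1) * 2 by rw [← pow_succ, Nat.sub_add_cancel hσ]]; ring
  set A₁ := ∑' l, ENNReal.ofReal (sobolevWeight 1 l) * ‖u l‖ₑ with hA₁
  have hA₁fin : A₁ < ∞ := tsum_weight_mul_enorm_lt_top hu 1
  -- finiteness
  have huσ1 : eNormSq ((σ : ℝ) + 1) u < ∞ := eNormSq_lt_top_of_rapidDecay hu _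
  have huσ : eNormSq (σ : ℝ) u < ∞ := eNormSq_lt_top_of_rapidDecay hu _
  have hG1 : eNormSq 1 (wmul (σ : ℝ) u) < ∞ := by rw [eNormSq_wmul, add_comm]; exact huσ1
  have hG0 : eNormSq 0 (wmul (σ : ℝ) u) < ∞ := (eNormSq_mono zero_le_one _).trans_lt hG1
  have hG0' : eNormSq (-0) (wmul (σ : ℝ) u) < ∞ := by rw [neg_zero]; exact hG0
  have hut : Tempered u := hu.tempered
  have hdu : ∀ j, eNormSq ((σ : ℝ) - 1) (freqDeriv j u) < ∞ := fun j =>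
    (eNormSq_freqDeriv_le _ j u).trans_lt (ENNReal.mul_lt_top ENNReal.ofReal_lt_top (by
      rw [sub_add_cancel]; exact huσ))
  have hdG0 : ∀ j, eNormSq 0 (freqDeriv j (wmul (σ : ℝ) u)) < ∞ := fun j =>
    (eNormSq_freqDeriv_le 0 j _).trans_lt (ENNReal.mul_lt_top ENNReal.ofReal_lt_top (by
      rwa [zero_add]))
  -- bounds on the symbol and target norms
  have hsymbσ : ∀ j, eNormSq (σ : ℝ) (scal (y j) : (d → ℤ) → (V →L[ℂ] V)) ≤ eNormSq (σ : ℝ) u :=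
    fun j => eNormSq_le_of_norm_le_norm fun p => norm_scal_comp_le π hπ u j p
  have hsymb1 : ∀ j, symbNorm 1 (scal (y j) : (d → ℤ) → (V →L[ℂ] V)) ≤ A₁ := fun j =>
    ENNReal.tsum_le_tsum fun p => by
      rw [← ofReal_norm, ← ofReal_norm]
      exact mul_le_mul' le_rfl (ENNReal.ofReal_le_ofReal (norm_scal_comp_le π hπ u j p))
  have hA0 : ∀ j, ∑' l, ‖freqDeriv j u l‖ₑ ≤ ENNReal.ofReal (2 * Real.pi) * A₁ :=
    fun j => tsum_enorm_freqDeriv_le j u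
  have hdσ : ∀ j, eNormSq ((σ : ℝ) - 1) (freqDeriv j u) ≤
      ENNReal.ofReal ((2 * Real.pi) ^ 2) * eNormSq (σ : ℝ) u := fun j => by
    have h := eNormSq_freqDeriv_le ((σ : ℝ) - 1) j u; rwa [sub_add_cancel] at h
  -- the commutators and their bound `‖R_j‖₀² ≤ (2C·2π)² A₁² ‖u‖_σ²`
  set R : d → (d → ℤ) → V := fun j =>
    wmul (σ : ℝ) (conv (scal (y j)) (freqDeriv j u)) - conv (scal (y j)) (wmul (σ : ℝ) (freqDeriv j u))
    with hR
  have hRle : ∀ j, eNormSq 0 (R j) ≤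
      ENNReal.ofReal ((2 * C * (2 * Real.pi)) ^ 2) * A₁ ^ 2 * eNormSq (σ : ℝ) u := by
    intro j
    calc eNormSq 0 (R j)
        ≤ 2 * ENNReal.ofReal (C ^ 2) * (eNormSq (σ : ℝ) (scal (y j) : (d → ℤ) → (V →L[ℂ] V)) *
            (∑' l, ‖freqDeriv j u l‖ₑ) ^ 2 + symbNorm 1 (scal (y j) : (d → ℤ) → (V →L[ℂ] V)) ^ 2 *
              eNormSq ((σ : ℝ) - 1) (freqDeriv j u)) :=
          eNormSq_wmul_natCast_conv_sub_le (ha j) (hut.freqDeriv j) hσ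
      _ ≤ 2 * ENNReal.ofReal (C ^ 2) * (eNormSq (σ : ℝ) u * (ENNReal.ofReal (2 * Real.pi) * A₁) ^ 2
            + A₁ ^ 2 * (ENNReal.ofReal ((2 * Real.pi) ^ 2) * eNormSq (σ : ℝ) u)) := by
          gcongr
          · exact hsymbσ j
          · exact hA0 j
          · exact hsymb1 j
          · exact hdσ j
      _ = ENNReal.ofReal ((2 * C * (2 * Real.pi)) ^ 2) * A₁ ^ 2 * eNormSq (σ : ℝ) u := by
          have e1 : ENNReal.ofReal ((2 * Real.pi) ^ 2) = ENNReal.ofReal (2 * Real.pi) ^ 2 :=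
            ENNReal.ofReal_pow (by positivity) 2
          have e2 : ENNReal.ofReal ((2 * C * (2 * Real.pi)) ^ 2) =
              4 * ENNReal.ofReal (C ^ 2) * ENNReal.ofReal (2 * Real.pi) ^ 2 := by
            rw [show (2 * C * (2 * Real.pi)) ^ 2 = 4 * (C ^ 2 * (2 * Real.pi) ^ 2) by ring,
              ENNReal.ofReal_mul (by norm_num), ENNReal.ofReal_mul (by positivity), e1,
              show ENNReal.ofReal (4 : ℝ) = 4 by norm_num, mul_assoc]
          rw [e1, e2]
          ring
  have hRfin : ∀ j, eNormSq 0 (R j) < ∞ := fun j =>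
    (hRle j).trans_lt (ENNReal.mul_lt_top (ENNReal.mul_lt_top ENNReal.ofReal_lt_top
      (ENNReal.pow_lt_top hA₁fin)) huσ)
  -- decomposition and skew part
  have hdec : wmul (σ : ℝ) (∑ j, conv (scal (y j)) (freqDeriv j u)) =
      (∑ j, conv (scal (y j)) (freqDeriv j (wmul (σ : ℝ) u))) + ∑ j, R j := by
    rw [wmul_finset_sum, ← Finset.sum_add_distrib]
    refine Finset.sum_congr rfl fun j _ => ?_
    rw [hR, ← wmul_freqDeriv]
    simp only
    abel
  have hsP : Summable fun k =>
      ⟪(∑ j, conv (scal (y j)) (freqDeriv j (wmul (σ : ℝ) u))) k, wmul (σ : ℝ) u k⟫_ℂ :=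
    summable_inner_finset_sum_left _ fun j _ =>
      summable_inner (eNormSq_conv_lt_top (ha j) (hdG0 j)) hG0'
  have hsR : ∀ j, Summable fun k => ⟪R j k, wmul (σ : ℝ) u k⟫_ℂ := fun j =>
    summable_inner (hRfin j) hG0'
  have hsplit : pairing (wmul (σ : ℝ) (∑ j, conv (scal (y j)) (freqDeriv j u))) (wmul (σ : ℝ) u) =
      pairing (∑ j, conv (scal (y j)) (freqDeriv j (wmul (σ : ℝ) u))) (wmul (σ : ℝ) u)
        + ∑ j, pairing (R j) (wmul (σ : ℝ) u) := by
    rw [hdec, pairing_add_left hsP (summable_inner_finset_sum_left _ fun j _ => hsR j),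
      pairing_finset_sum_left_of_summable _ fun j _ => hsR j]
  have hyreal : ∀ j p, y j (-p) = conj (y j p) := fun j p => hreal j p
  have hydiv : ∑ j, freqDeriv j (y j) = 0 := hdiv
  have hskew := re_pairing_transport_eq_zero y hyr hyreal hydiv hG1
  -- each commutator pairing
  have hnormG : (eNorm (-0) (wmul (σ : ℝ) u)).toReal = (eNorm (σ : ℝ) u).toReal := by
    rw [neg_zero, eNorm_wmul, zero_add]
  have hsqσ : (eNorm (σ : ℝ) u).toReal ^ 2 = (eNormSq (σ : ℝ) u).toReal := toReal_eNorm_sq _ _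
  have hRj : ∀ j, ‖pairing (R j) (wmul (σ : ℝ) u)‖ ≤
      2 * C * (2 * Real.pi) * A₁.toReal * (eNormSq (σ : ℝ) u).toReal := by
    intro j
    have h1 : (eNorm 0 (R j)).toReal ≤ 2 * C * (2 * Real.pi) * A₁.toReal * (eNorm (σ : ℝ) u).toReal := by
      have hsq : eNorm 0 (R j) ≤ ENNReal.ofReal (2 * C * (2 * Real.pi)) * A₁ * eNorm (σ : ℝ) u := by
        calc eNorm 0 (R j) = (eNormSq 0 (R j)) ^ (1 / 2 : ℝ) := rfl
          _ ≤ (ENNReal.ofReal ((2 * C * (2 * Real.pi)) ^ 2) * A₁ ^ 2 * eNormSq (σ : ℝ) u) ^ (1 / 2 : ℝ) := by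
              gcongr; exact hRle j
          _ = ENNReal.ofReal (2 * C * (2 * Real.pi)) * A₁ * eNorm (σ : ℝ) u := by
              rw [ENNReal.ofReal_pow (by positivity), ← mul_pow,
                ENNReal.mul_rpow_of_nonneg _ _ (by norm_num), ennreal_sq_rpow_half, eNorm]
      have hfin : ENNReal.ofReal (2 * C * (2 * Real.pi)) * A₁ * eNorm (σ : ℝ) u ≠ ∞ :=
        ENNReal.mul_ne_top (ENNReal.mul_ne_top ENNReal.ofReal_ne_top hA₁fin.ne)
          (eNorm_lt_top_iff.2 huσ).ne
      have := ENNReal.toReal_mono hfin hsq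
      rwa [ENNReal.toReal_mul, ENNReal.toReal_mul, ENNReal.toReal_ofReal (by positivity)] at this
    have hn0 : 0 ≤ (eNorm (σ : ℝ) u).toReal := ENNReal.toReal_nonneg
    calc ‖pairing (R j) (wmul (σ : ℝ) u)‖
        ≤ (eNorm 0 (R j)).toReal * (eNorm (-0) (wmul (σ : ℝ) u)).toReal := norm_pairing_le (hRfin j) hG0'
      _ ≤ (2 * C * (2 * Real.pi) * A₁.toReal * (eNorm (σ : ℝ) u).toReal) * (eNorm (σ : ℝ) u).toReal := by
          rw [hnormG]; exact mul_le_mul_of_nonneg_right h1 hn0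
      _ = 2 * C * (2 * Real.pi) * A₁.toReal * (eNorm (σ : ℝ) u).toReal ^ 2 := by ring
      _ = _ := by rw [hsqσ]
  -- assemble
  rw [hsplit, Complex.add_re, hskew, zero_add, Complex.re_sum]
  calc |∑ j, (pairing (R j) (wmul (σ : ℝ) u)).re| ≤ ∑ j, |(pairing (R j) (wmul (σ : ℝ) u)).re| :=
        Finset.abs_sum_le_sum_abs _ _
    _ ≤ ∑ _j : d, 2 * C * (2 * Real.pi) * A₁.toReal * (eNormSq (σ : ℝ) u).toReal :=
        Finset.sum_le_sum fun j _ => (Complex.abs_re_le_norm _).trans (hRj j)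
    _ = _ := by rw [Finset.sum_const, Finset.card_univ, nsmul_eq_mul, ← hC2]; ring

end SelfTransport


/-! ## §5 The order-`σ` energy inequality of the perturbation field -/

section Field

omit [CompleteSpace V] in
/-- `Λ^s` commutes with a modewise linear family. -/
theorem wmul_apply_comm (P : (d → ℤ) → (V →L[ℂ] V)) (s : ℝ) (f : (d → ℤ) → V) :
    wmul s (fun k => P k (f k)) = fun k => P k (wmul s f k) := by
  funext k; simp only [wmul_apply, map_smul]

omit [CompleteSpace V] in
/-- Summability of a pairing of two rapidly decreasing families after `Λ^s`. -/
theorem summable_inner_wmul {f u : (d → ℤ) → V} (hf : RapidDecay f) (hu : RapidDecay u) (s : ℝ) :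
    Summable fun k => ⟪wmul s f k, wmul s u k⟫_ℂ :=
  summable_inner (eNormSq_lt_top_of_rapidDecay (rapidDecay_wmul hf s) 0)
    (by rw [neg_zero]; exact eNormSq_lt_top_of_rapidDecay (rapidDecay_wmul hu s) 0)

/-- **The order-`σ` energy inequality of the perturbation field** (`σ ∈ ℕ`, `σ ≥ 1`, `ν ≥ 0`). Host:
a rapidly decreasing coefficient family `Uv`, real and divergence-free through coordinate functionals
`π_j` of norm `≤ 1`; Leray symbol: any modewise self-adjoint family `P` FIXING the unknown; unknown:
a rapidly decreasing `u` (every Galerkin level is finitely supported), `P`-fixed, real and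
divergence-free through `π` — exactly the clauses of `TransportGalerkin.box`. Then, with
`S_s = ‖u‖_s²` (`(Lattice.eNormSq s u).toReal`), `A₁(u) = ∑_p ⟨p⟩ ‖u p‖` and the coefficient
fields `linCoeff` / `bilCoeff` of `TransportGalerkinDefs`,

  `2 Re ⟨Λ^σ P(linCoeff ν Uv π u + bilCoeff π u u), Λ^σ u⟩
     ≤ −2ν(2π)² (S_{σ+1} − S_σ) + 2 (H₁ + H₂ + K_σ A₁(u)) S_σ`,

`H₁ = σ2^σ·2π·∑_j A_σ(scal(π_j∘Uv))`, `H₂ = 2^{σ/2}·card d·2π·A_{σ+1}(Uv)`, `K_σ = card d·σ2^σ·2π`.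
Along a Galerkin level `t ↦ û(t)` the left side is `d/dt S_σ` (the cube truncation is invisible in
the pairing against the truncated `û`), so this is the differential inequality behind residence:
level-INDEPENDENT constants, one super-linear factor `A₁(û)`, and an exact dissipation term to absorb
it (part VII). -/
theorem two_re_pairing_field_le (ν : ℝ) {Uv : (d → ℤ) → V} (hUv : RapidDecay Uv)
    (π : d → (V →L[ℂ] ℂ)) (hπ : ∀ j, ‖π j‖ ≤ 1)
    (hUreal : ∀ j p, π j (Uv (-p)) = conj (π j (Uv p)))
    (hUdiv : ∑ j, freqDeriv j (fun p => π j (Uv p)) = 0)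
    (P : (d → ℤ) → (V →L[ℂ] V)) (hPsa : ∀ k, IsSelfAdjoint (P k))
    {u : (d → ℤ) → V} (hu : RapidDecay u) (hfix : ∀ k, P k (u k) = u k)
    (hreal : ∀ j p, π j (u (-p)) = conj (π j (u p)))
    (hdiv : ∑ j, freqDeriv j (fun p => π j (u p)) = 0) {σ : ℕ} (hσ : 1 ≤ σ) :
    2 * (pairing (wmul (σ : ℝ) (fun k => P k (linCoeff ν Uv π u k + bilCoeff π u u k)))
        (wmul (σ : ℝ) u)).re ≤
      -(2 * ν * (2 * Real.pi) ^ 2 *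
          ((eNormSq ((σ : ℝ) + 1) u).toReal - (eNormSq (σ : ℝ) u).toReal))
      + 2 * ((σ * (2 : ℝ) ^ σ) * (2 * Real.pi) *
              (∑ j, (symbNorm (σ : ℝ) (scal (fun p => π j (Uv p)) : (d → ℤ) → (V →L[ℂ] V))).toReal)
            + (2 : ℝ) ^ ((σ : ℝ) / 2) * ((Fintype.card d : ℝ) * (2 * Real.pi)) *
              (∑' l, ENNReal.ofReal (sobolevWeight ((σ : ℝ) + 1) l) * ‖Uv l‖ₑ).toReal
            + (Fintype.card d : ℝ) * (σ * (2 : ℝ) ^ σ) * (2 * Real.pi) *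
              (∑' l, ENNReal.ofReal (sobolevWeight 1 l) * ‖u l‖ₑ).toReal) *
          (eNormSq (σ : ℝ) u).toReal := by
  -- names
  set L := ∑ j, freqDeriv j (freqDeriv j u) with hL
  set T₁ := ∑ j, conv (scal (fun p => π j (Uv p)) : (d → ℤ) → (V →L[ℂ] V)) (freqDeriv j u) with hT₁
  set T₂ := ∑ j, conv (scal (fun p => π j (u p)) : (d → ℤ) → (V →L[ℂ] V)) (freqDeriv j Uv) with hT₂
  set T₃ := ∑ j, conv (scal (fun p => π j (u p)) : (d → ℤ) → (V →L[ℂ] V)) (freqDeriv j u) with hT₃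
  set G := wmul (σ : ℝ) u with hG
  -- rapid decay of the pieces
  have hLr : RapidDecay L := RapidDecay.finset_sum _ fun j _ => (hu.freqDeriv' j).freqDeriv' j
  have hT₁r : RapidDecay T₁ :=
    RapidDecay.finset_sum _ fun j _ => (hu.freqDeriv' j).conv_right (hUv.comp_apply (π j)).scal
  have hT₂r : RapidDecay T₂ :=
    RapidDecay.finset_sum _ fun j _ => (hUv.freqDeriv' j).conv_right (hu.comp_apply (π j)).scal
  have hT₃r : RapidDecay T₃ :=
    RapidDecay.finset_sum _ fun j _ => (hu.freqDeriv' j).conv_right (hu.comp_apply (π j)).scal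
  -- (a) drop the Leray symbol
  set f : (d → ℤ) → V := fun k => linCoeff ν Uv π u k + bilCoeff π u u k with hf
  have hdrop : pairing (wmul (σ : ℝ) (fun k => P k (f k))) G = pairing (wmul (σ : ℝ) f) G := by
    rw [wmul_apply_comm]
    exact pairing_apply_eq_of_isSelfAdjoint P hPsa _ _ fun k => by
      rw [hG, wmul_apply, map_smul, hfix]
  -- (b) split the field: `Λ^σ f = ν Λ^σ L − Λ^σ T₁ − Λ^σ T₂ − Λ^σ T₃`
  have hfsplit : wmul (σ : ℝ) f =
      (ν : ℂ) • wmul (σ : ℝ) L - wmul (σ : ℝ) T₁ - wmul (σ : ℝ) T₂ - wmul (σ : ℝ) T₃ := by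
    funext k
    simp only [hf, wmul_apply, linCoeff_eq, bilCoeff_eq, Pi.sub_apply, Pi.smul_apply,
      Pi.neg_apply, smul_sub, smul_add, smul_neg, smul_smul, mul_comm (ν : ℂ), hL, hT₁, hT₂, hT₃]
    abel
  have hsL := summable_inner_wmul hLr hu (σ : ℝ)
  have hsL' : Summable fun k => ⟪((ν : ℂ) • wmul (σ : ℝ) L) k, G k⟫_ℂ := by
    refine (hsL.const_smul (conj (ν : ℂ))).congr fun k => ?_
    rw [Pi.smul_apply, inner_smul_left, smul_eq_mul]
  have hs₁ : Summable fun k => ⟪wmul (σ : ℝ) T₁ k, G k⟫_ℂ := summable_inner_wmul hT₁r hu (σ : ℝ)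
  have hs₂ : Summable fun k => ⟪wmul (σ : ℝ) T₂ k, G k⟫_ℂ := summable_inner_wmul hT₂r hu (σ : ℝ)
  have hs₃ : Summable fun k => ⟪wmul (σ : ℝ) T₃ k, G k⟫_ℂ := summable_inner_wmul hT₃r hu (σ : ℝ)
  have hpsplit : pairing (wmul (σ : ℝ) f) G =
      (ν : ℂ) * pairing (wmul (σ : ℝ) L) G - pairing (wmul (σ : ℝ) T₁) G
        - pairing (wmul (σ : ℝ) T₂) G - pairing (wmul (σ : ℝ) T₃) G := by
    have hsub1 : Summable fun k => ⟪((ν : ℂ) • wmul (σ : ℝ) L - wmul (σ : ℝ) T₁) k, G k⟫_ℂ := by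
      refine (hsL'.sub hs₁).congr fun k => ?_; simp only [Pi.sub_apply, inner_sub_left]
    have hsub2 : Summable fun k =>
        ⟪((ν : ℂ) • wmul (σ : ℝ) L - wmul (σ : ℝ) T₁ - wmul (σ : ℝ) T₂) k, G k⟫_ℂ := by
      refine (hsub1.sub hs₂).congr fun k => ?_; simp only [Pi.sub_apply, inner_sub_left]
    rw [hfsplit, pairing_sub_left hsub2 hs₃, pairing_sub_left hsub1 hs₂, pairing_sub_left hsL' hs₁,
      pairing_smul_left, Complex.conj_ofReal]
  -- (c) the four estimates
  have huσ1 : eNormSq ((σ : ℝ) + 1) u < ∞ := eNormSq_lt_top_of_rapidDecay hu _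
  have huσ : eNormSq (σ : ℝ) u < ∞ := eNormSq_lt_top_of_rapidDecay hu _
  have hdiss : (pairing (wmul (σ : ℝ) L) G).re =
      -((2 * Real.pi) ^ 2 * ((eNormSq ((σ : ℝ) + 1) u).toReal - (eNormSq (σ : ℝ) u).toReal)) :=
    re_pairing_wmul_laplacian_eq (σ : ℝ) huσ1
  have h₁ := abs_re_pairing_wmul_natCast_transport_le (V := V) (fun j p => π j (Uv p))
    (fun j => hUv.comp_apply (π j)) hUreal hUdiv hσ huσ1
  have h₂ := abs_re_pairing_wmul_stretching_le (by positivity : (0 : ℝ) ≤ (σ : ℝ)) π hπ Uv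
    (tsum_weight_mul_enorm_lt_top hUv _) huσ
  have h₃ := abs_re_pairing_wmul_natCast_transport_self_le π hπ hu hreal hdiv hσ
  -- assemble
  rw [hdrop, hpsplit]
  simp only [Complex.sub_re, Complex.mul_re, Complex.ofReal_re, Complex.ofReal_im, zero_mul,
    sub_zero, hdiss]
  have e₁ := (abs_le.1 h₁).1
  have e₂ := (abs_le.1 h₂).1
  have e₃ := (abs_le.1 h₃).1
  nlinarith [e₁, e₂, e₃]

end Field


end Summit.NavierStokesRegularity.FluidComputer.TransportSobolevSelfAdvection

end
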